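import Mathlib
import Literature.AlgebraicGeometry.Resolution.BlowupChartRsop
import Literature.AlgebraicGeometry.Resolution.AffineBlowupAlgebra
import HarnessLib

/-!
# The `K₃` blow-up of `𝔸ⁿ`: the vertex charts `B1 = D₊(x_b⁶ t)` and `B2b = D₊(x_a x_b⁴ t)` are affine spaces

(crux stmt-ResolutionOfSingularities-15640 `WildQuotients.WildQuotientResolution`, line `Sketch`;
rung V3 of `L/w45c/CHAIN.md` v4 in the ONE-BLOW-UP design of record (res-L1-w45c-lead-1 RULING
2026-08-27T01:07:58Z, res-L1-w45c-stub-4 PROPOSAL V3-ONE-BLOWUP): the three-step plain tower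
resolving `𝔸ⁿ/⟨J₃⟩` in characteristic `3` is the single blow-up of `𝔸ⁿ` along the `σ`-stable
monomial ideal `K₃ = (x_a⁴, x_a³x_b, x_a²x_b³, x_a x_b⁴, x_b⁶)` — a smooth toric surface times
`𝔸ⁿ⁻²`; [OURS · L1 W4.5c] — NOT a statement of any manuscript.)

This file supplies the REGULARITY of two of the four vertex charts of `Bl_{K₃} 𝔸ⁿ`
(res-L1-w45c-stub-4 owns the other two and the assembly), by exhibiting the chart rings as
polynomial rings in `n` variables:

* `B1 = D₊(x_b⁶ t)`: `k[x][K₃/x_b⁶] = k[x_b, v, (x_s)_{s ≠ a,b}]` with `v = x_a x_b⁴ / x_b⁶ = x_a/x_b²`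
  (`x_a = v x_b²`) — `isRegularRing_chartRing_k3_B1`;
* `B2b = D₊(x_a x_b⁴ t)`: `k[x][K₃/x_a x_b⁴] = k[w, z, (x_s)_{s ≠ a,b}]` with `w = x_b⁶/(x_a x_b⁴) = x_b²/x_a`,
  `z = x_a³x_b/(x_a x_b⁴) = x_a²/x_b³` (`x_a = w³z²`, `x_b = w²z`) — `isRegularRing_chartRing_k3_B2b`.

Both are instances of one generic presentation lemma, `nonempty_chartRing_ringEquiv_of_chartData`
(pattern of `Literature…CoordinateBlowupChart`): a `k`-algebra map `Θ : k[x] → k[x][1/cᵢ]` with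
values in the affine blowup algebra `k[x][I/cᵢ]`, hitting every `c_j/cᵢ` and every `x_s` (through
a substitution `ω` with `Θ ∘ ω = ι`), and retracted by the extension `Ω` of `ω` to `k[x][1/cᵢ]`
(`Ω ∘ Θ = ι`), is an isomorphism onto `k[x][I/cᵢ] ≅ (k[x][It])_{(cᵢt)}` (`reesChartEquiv`); hence
the chart ring is a polynomial ring and regular.
-/

-- single-problem summit: the doubled namespace component `ResolutionOfSingularities` is forced
set_option linter.dupNamespace false

noncomputable section

open MvPolynomial IsLocalization Literature.AlgebraicGeometry.Resolution

namespace Summit.ResolutionOfSingularities.ResolutionOfSingularities.Theorems.WildQuotientResolution.JordanThree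

section Generic

variable {k : Type} [Field k] {n m : ℕ}

/-- `ι A · (1/a)^d = ι B · (1/a)^{d'}` in `R[1/a]` as soon as `A a^{d'} = B a^d` in `R`.
[folklore] -/
theorem algebraMap_mul_invSelf_pow_eq {R : Type} [CommRing R] (a A B : R) (d d' : ℕ)
    (h : A * a ^ d' = B * a ^ d) :
    algebraMap R (Localization.Away a) A * Away.invSelf a ^ d =
      algebraMap R (Localization.Away a) B * Away.invSelf a ^ d' := by
  have hu : algebraMap R (Localization.Away a) a * Away.invSelf a = 1 := Away.mul_invSelf a
  calc algebraMap R (Localization.Away a) A * Away.invSelf a ^ d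
      = algebraMap R (Localization.Away a) A * Away.invSelf a ^ d *
          (algebraMap R (Localization.Away a) a * Away.invSelf a) ^ d' := by
        rw [hu, one_pow, mul_one]
    _ = algebraMap R (Localization.Away a) (A * a ^ d') * Away.invSelf a ^ (d + d') := by
        rw [map_mul, map_pow]; ring
    _ = algebraMap R (Localization.Away a) (B * a ^ d) * Away.invSelf a ^ (d + d') := by rw [h]
    _ = algebraMap R (Localization.Away a) B * Away.invSelf a ^ d' *
          (algebraMap R (Localization.Away a) a * Away.invSelf a) ^ d := by
        rw [map_mul, map_pow]; ring
    _ = algebraMap R (Localization.Away a) B * Away.invSelf a ^ d' := by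
        rw [hu, one_pow, mul_one]

/-- **Chart presentations by substitution** (pattern of `Literature…coordBlowupReesChartEquiv`).
Let `c : Fin m → k[x₁,…,xₙ]`, `cᵢ ≠ 0`, `I = (c)`, and let `Θ : k[x] → k[x][1/cᵢ]` be a `k`-algebra
map with values in the affine blowup algebra `k[x][I/cᵢ]`, hitting every `c_j/cᵢ`, and such that a
substitution `ω` of `k[x]` satisfies `Θ (ω x_s) = x_s`, `ω(cᵢ) | cᵢ^N`, and every `Θ x_s` is a
fraction `r/cᵢ^d` with `ω r = x_s · ω(cᵢ)^d`. Then `Θ` is an isomorphism `k[x] ≅ k[x][I/cᵢ]`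
(surjective: the image is a `k[x]`-subalgebra containing the generators; injective: the extension
`Ω` of `ω` to `k[x][1/cᵢ]` retracts it onto the injective localisation map), so the chart ring
`(k[x][It])_{(cᵢ t)} ≅ k[x][I/cᵢ]` (`reesChartEquiv`) is a polynomial ring in `n` variables.
[cite: StacksProject, Tag 0804] [cite: GortzWedhorn2020, (13.19) p. 415] -/
theorem nonempty_chartRing_ringEquiv_of_chartData (c : Fin m → MvPolynomial (Fin n) k) (i : Fin m)
    (hci : c i ≠ 0)
    (Θ : MvPolynomial (Fin n) k →ₐ[k] Localization.Away (c i))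
    (ω : MvPolynomial (Fin n) k →ₐ[k] MvPolynomial (Fin n) k)
    (hΘω : ∀ s, Θ (ω (X s)) = algebraMap (MvPolynomial (Fin n) k) (Localization.Away (c i)) (X s))
    (hΘmem : ∀ s, Θ (X s) ∈ blowupAlgebra (Ideal.span (Set.range c)) (c i))
    (hgen : ∀ j, ∃ P, Θ P = algebraMap _ (Localization.Away (c i)) (c j) * Away.invSelf (c i))
    (hωunit : ∃ (q : MvPolynomial (Fin n) k) (N : ℕ), ω (c i) * q = c i ^ N)
    (hωX : ∀ s, ∃ (r : MvPolynomial (Fin n) k) (d : ℕ),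
      Θ (X s) = algebraMap _ (Localization.Away (c i)) r * Away.invSelf (c i) ^ d ∧
        ω r = X s * ω (c i) ^ d) :
    Nonempty (chartRing c i ≃+* MvPolynomial (Fin n) k) := by
  set L := Localization.Away (c i)
  set ι := algebraMap (MvPolynomial (Fin n) k) L with hιdef
  have hιinj : Function.Injective ι :=
    IsLocalization.injective L (M := Submonoid.powers (c i))
      (Submonoid.powers_le.2 (mem_nonZeroDivisors_of_ne_zero hci))
  -- `Θ ∘ ω = ι`
  have hΘωall : ∀ r, Θ (ω r) = ι r := by
    intro r
    have h : Θ.comp ω = IsScalarTower.toAlgHom k (MvPolynomial (Fin n) k) L :=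
      MvPolynomial.algHom_ext fun s => by
        rw [AlgHom.comp_apply, IsScalarTower.toAlgHom_apply, hΘω]
    exact DFunLike.congr_fun h r
  -- (1) the image lies in the affine blowup algebra
  have hsub : ∀ p, Θ p ∈ blowupAlgebra (Ideal.span (Set.range c)) (c i) := by
    intro p
    induction p using MvPolynomial.induction_on with
    | C a =>
      rw [← MvPolynomial.algebraMap_eq, AlgHom.commutes,
        IsScalarTower.algebraMap_apply k (MvPolynomial (Fin n) k) L]
      exact Subalgebra.algebraMap_mem _ _
    | add p q hp hq =>
      rw [map_add]
      exact Subalgebra.add_mem _ hp hq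
    | mul_X p s hp =>
      rw [map_mul]
      exact Subalgebra.mul_mem _ hp (hΘmem s)
  -- (2) the image is the whole affine blowup algebra
  have hsup : ∀ z, z ∈ blowupAlgebra (Ideal.span (Set.range c)) (c i) → z ∈ Set.range Θ := by
    let B : Subalgebra (MvPolynomial (Fin n) k) L :=
      { carrier := Set.range Θ
        mul_mem' := by
          rintro _ _ ⟨p, rfl⟩ ⟨q, rfl⟩
          exact ⟨p * q, map_mul _ _ _⟩
        one_mem' := ⟨1, map_one _⟩
        add_mem' := by
          rintro _ _ ⟨p, rfl⟩ ⟨q, rfl⟩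
          exact ⟨p + q, map_add _ _ _⟩
        zero_mem' := ⟨0, map_zero _⟩
        algebraMap_mem' := fun r => ⟨ω r, hΘωall r⟩ }
    have hle : blowupAlgebra (Ideal.span (Set.range c)) (c i) ≤ B := by
      refine Algebra.adjoin_le ?_
      rintro _ ⟨x, hx, rfl⟩
      refine Submodule.span_induction (p := fun x _ => ι x * Away.invSelf (c i) ∈ B) ?_ ?_ ?_ ?_ hx
      · rintro _ ⟨j, rfl⟩
        obtain ⟨P, hP⟩ := hgen j
        exact ⟨P, hP⟩
      · rw [map_zero, zero_mul]
        exact B.zero_mem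
      · intro x y _ _ hx hy
        rw [map_add, add_mul]
        exact B.add_mem hx hy
      · intro r x _ hx
        rw [smul_eq_mul, map_mul, mul_assoc]
        exact B.mul_mem (B.algebraMap_mem r) hx
    intro z hz
    exact hle hz
  -- (3) `Θ` is injective: `Ω ∘ Θ = ι` for the extension `Ω` of `ω` to `k[x][1/cᵢ]`
  obtain ⟨q, N, hq⟩ := hωunit
  let g : MvPolynomial (Fin n) k →+* L := ι.comp ω.toRingHom
  have hg : IsUnit (g (c i)) := by
    have hN : IsUnit (ι (c i ^ N)) := by
      rw [map_pow]
      exact (IsLocalization.Away.algebraMap_isUnit (S := L) (c i)).pow N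
    rw [← hq, map_mul] at hN
    exact isUnit_of_mul_isUnit_left hN
  let Ω : L →+* L := IsLocalization.Away.lift (c i) hg
  have hΩι : ∀ r, Ω (ι r) = ι (ω r) := fun r => IsLocalization.Away.lift_eq (c i) hg r
  have hΩinv : ι (ω (c i)) * Ω (Away.invSelf (c i)) = 1 := by
    have h1 : Ω (ι (c i) * Away.invSelf (c i)) = 1 := by
      rw [hιdef, Away.mul_invSelf, map_one]
    rwa [map_mul, hΩι] at h1
  have hΩΘ : ∀ s, Ω (Θ (X s)) = ι (X s) := by
    intro s
    obtain ⟨r, d, h1, h2⟩ := hωX s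
    rw [h1, map_mul, map_pow, hΩι, h2, map_mul, map_pow, mul_assoc, ← mul_pow, hΩinv, one_pow,
      mul_one]
  have hcomp : Ω.comp Θ.toRingHom = ι := by
    refine MvPolynomial.ringHom_ext (fun a => ?_) (fun s => ?_)
    · rw [RingHom.comp_apply, AlgHom.toRingHom_eq_coe, RingHom.coe_coe, ← MvPolynomial.algebraMap_eq,
        AlgHom.commutes, IsScalarTower.algebraMap_apply k (MvPolynomial (Fin n) k) L, ← hιdef, hΩι,
        AlgHom.commutes]
    · rw [RingHom.comp_apply, AlgHom.toRingHom_eq_coe, RingHom.coe_coe, hΩΘ]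
  have hΩΘall : ∀ r, Ω (Θ r) = ι r := fun r => DFunLike.congr_fun hcomp r
  have hΘinj : Function.Injective Θ := by
    intro p p' h
    apply hιinj
    rw [← hΩΘall p, ← hΩΘall p', h]
  -- (4) assemble
  let Θ' : MvPolynomial (Fin n) k →+* blowupAlgebra (Ideal.span (Set.range c)) (c i) :=
    Θ.toRingHom.codRestrict (blowupAlgebra (Ideal.span (Set.range c)) (c i)).toSubring hsub
  have hΘ' : Function.Bijective Θ' := by
    refine ⟨fun p p' h => hΘinj (congrArg Subtype.val h), fun z => ?_⟩
    obtain ⟨p, hp⟩ := hsup z z.2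
    exact ⟨p, Subtype.ext hp⟩
  exact ⟨(reesChartEquiv (c i) (Ideal.mem_span_range_self (f := c) (x := i))).trans
    (RingEquiv.ofBijective Θ' hΘ').symm⟩

/-- **Regularity of a chart presented by substitution**: under the hypotheses of
`nonempty_chartRing_ringEquiv_of_chartData` the chart ring `(k[x][It])_{(cᵢt)}` is a regular ring
(a polynomial ring over a field). [folklore] -/
theorem isRegularRing_chartRing_of_chartData (c : Fin m → MvPolynomial (Fin n) k) (i : Fin m)
    (hci : c i ≠ 0)
    (Θ : MvPolynomial (Fin n) k →ₐ[k] Localization.Away (c i))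
    (ω : MvPolynomial (Fin n) k →ₐ[k] MvPolynomial (Fin n) k)
    (hΘω : ∀ s, Θ (ω (X s)) = algebraMap (MvPolynomial (Fin n) k) (Localization.Away (c i)) (X s))
    (hΘmem : ∀ s, Θ (X s) ∈ blowupAlgebra (Ideal.span (Set.range c)) (c i))
    (hgen : ∀ j, ∃ P, Θ P = algebraMap _ (Localization.Away (c i)) (c j) * Away.invSelf (c i))
    (hωunit : ∃ (q : MvPolynomial (Fin n) k) (N : ℕ), ω (c i) * q = c i ^ N)
    (hωX : ∀ s, ∃ (r : MvPolynomial (Fin n) k) (d : ℕ),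
      Θ (X s) = algebraMap _ (Localization.Away (c i)) r * Away.invSelf (c i) ^ d ∧
        ω r = X s * ω (c i) ^ d) :
    IsRegularRing (chartRing c i) := by
  obtain ⟨e⟩ := nonempty_chartRing_ringEquiv_of_chartData c i hci Θ ω hΘω hΘmem hgen hωunit hωX
  exact IsRegularRing.of_ringEquiv e.symm

end Generic

section K3

variable (k : Type) [Field k] (n : ℕ) (a b : Fin n)

/-- **Chart `B1 = D₊(x_b⁶ t)` of `Bl_{K₃} 𝔸ⁿ` is regular**: its ring is
`k[x][K₃/x_b⁶] = k[x_b, v, (x_s)_{s≠a,b}]`, `v = x_a/x_b²` — the chart map `x_a ↦ x_a x_b⁴/x_b⁶`,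
`x_s ↦ x_s` (`s ≠ a`) is an isomorphism onto the affine blowup algebra, retracted by
`x_a ↦ x_a x_b²`; the generators are `x_a⁴/x_b⁶ = v⁴x_b²`, `x_a³x_b/x_b⁶ = v³x_b`,
`x_a²x_b³/x_b⁶ = v²x_b`, `x_a x_b⁴/x_b⁶ = v`, `1`. [OURS · L1 W4.5c] [folklore] -/
theorem isRegularRing_chartRing_k3_B1 (hab : a ≠ b) :
    IsRegularRing (chartRing
      (![X a ^ 4, X a ^ 3 * X b, X a ^ 2 * X b ^ 3, X a * X b ^ 4, X b ^ 6] :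
        Fin 5 → MvPolynomial (Fin n) k) 4) := by
  classical
  set c : Fin 5 → MvPolynomial (Fin n) k :=
    ![X a ^ 4, X a ^ 3 * X b, X a ^ 2 * X b ^ 3, X a * X b ^ 4, X b ^ 6] with hc
  have hc0 : c 0 = X a ^ 4 := rfl
  have hc1 : c 1 = X a ^ 3 * X b := rfl
  have hc2 : c 2 = X a ^ 2 * X b ^ 3 := rfl
  have hc3 : c 3 = X a * X b ^ 4 := rfl
  have hc4 : c 4 = X b ^ 6 := rfl
  have hba : b ≠ a := fun h => hab h.symm
  set L := Localization.Away (c 4)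
  set ι := algebraMap (MvPolynomial (Fin n) k) L with hιdef
  have hu : ι (c 4) * Away.invSelf (c 4) = 1 := Away.mul_invSelf (c 4)
  -- the chart map and the substitution
  let Θ : MvPolynomial (Fin n) k →ₐ[k] L :=
    aeval fun s => if s = a then ι (c 3) * Away.invSelf (c 4) else ι (X s)
  let ω : MvPolynomial (Fin n) k →ₐ[k] MvPolynomial (Fin n) k :=
    aeval fun s => if s = a then X a * X b ^ 2 else X s
  have hΘa : Θ (X a) = ι (c 3) * Away.invSelf (c 4) := by simp [Θ]
  have hΘs : ∀ s, s ≠ a → Θ (X s) = ι (X s) := fun s hs => by simp [Θ, hs]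
  have hωa : ω (X a) = X a * X b ^ 2 := by simp [ω]
  have hωs : ∀ s, s ≠ a → ω (X s) = X s := fun s hs => by simp [ω, hs]
  have hωc4 : ω (c 4) = c 4 := by rw [hc4, map_pow, hωs b hba]
  have E := fun (A B : MvPolynomial (Fin n) k) (d d' : ℕ) (h : A * c 4 ^ d' = B * c 4 ^ d) =>
    algebraMap_mul_invSelf_pow_eq (c 4) A B d d' h
  refine isRegularRing_chartRing_of_chartData c 4 ?_ Θ ω ?_ ?_ ?_ ?_ ?_
  · rw [hc4]; exact pow_ne_zero _ (X_ne_zero b)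
  · intro s
    by_cases hs : s = a
    · subst hs
      rw [hωa, map_mul, map_pow, hΘa, hΘs b hba]
      have key := E (c 3 * X b ^ 2) (X s) 1 0 (by rw [hc3, hc4]; ring)
      rw [pow_one, pow_zero, mul_one, map_mul, map_pow] at key
      rw [← key]
      ring
    · rw [hωs s hs, hΘs s hs]
  · intro s
    by_cases hs : s = a
    · subst hs
      rw [hΘa]
      exact div_mem_blowupAlgebra _ _ (Ideal.mem_span_range_self (f := c) (x := 3))
    · rw [hΘs s hs]
      exact Subalgebra.algebraMap_mem _ _
  · intro j
    fin_cases j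
    · refine ⟨X a ^ 4 * X b ^ 2, ?_⟩
      change Θ _ = ι (c 0) * _
      have key := E (c 3 ^ 4 * X b ^ 2) (c 0) 4 1 (by rw [hc3, hc4, hc0]; ring)
      rw [pow_one, map_mul, map_pow, map_pow] at key
      rw [map_mul, map_pow, map_pow, hΘa, hΘs b hba, ← key]
      ring
    · refine ⟨X a ^ 3 * X b, ?_⟩
      change Θ _ = ι (c 1) * _
      have key := E (c 3 ^ 3 * X b) (c 1) 3 1 (by rw [hc3, hc4, hc1]; ring)
      rw [pow_one, map_mul, map_pow] at key
      rw [map_mul, map_pow, hΘa, hΘs b hba, ← key]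
      ring
    · refine ⟨X a ^ 2 * X b, ?_⟩
      change Θ _ = ι (c 2) * _
      have key := E (c 3 ^ 2 * X b) (c 2) 2 1 (by rw [hc3, hc4, hc2]; ring)
      rw [pow_one, map_mul, map_pow] at key
      rw [map_mul, map_pow, hΘa, hΘs b hba, ← key]
      ring
    · exact ⟨X a, hΘa⟩
    · refine ⟨1, ?_⟩
      change Θ 1 = ι (c 4) * _
      rw [map_one, hu]
  · exact ⟨1, 1, by rw [hωc4, mul_one, pow_one]⟩
  · intro s
    by_cases hs : s = a
    · subst hs
      refine ⟨c 3, 1, by rw [hΘa, pow_one], ?_⟩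
      rw [pow_one, hωc4, hc3, hc4, map_mul, map_pow, hωa, hωs b hba]
      ring
    · exact ⟨X s, 0, by rw [hΘs s hs, pow_zero, mul_one], by rw [pow_zero, mul_one, hωs s hs]⟩

/-- **Chart `B2b = D₊(x_a x_b⁴ t)` of `Bl_{K₃} 𝔸ⁿ` is regular**: its ring is
`k[x][K₃/x_a x_b⁴] = k[w, z, (x_s)_{s≠a,b}]`, `w = x_b²/x_a`, `z = x_a²/x_b³` (`x_a = w³z²`,
`x_b = w²z`) — the chart map `x_a ↦ x_b⁶/(x_a x_b⁴)`, `x_b ↦ x_a³x_b/(x_a x_b⁴)`, `x_s ↦ x_s`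
(`s ≠ a, b`) is an isomorphism onto the affine blowup algebra, retracted by `x_a ↦ x_a³x_b²`,
`x_b ↦ x_a²x_b`; the generators are `x_a⁴/(x_a x_b⁴) = wz²`, `z`, `x_a²x_b³/(x_a x_b⁴) = wz`, `1`,
`w`. [OURS · L1 W4.5c] [folklore] -/
theorem isRegularRing_chartRing_k3_B2b (hab : a ≠ b) :
    IsRegularRing (chartRing
      (![X a ^ 4, X a ^ 3 * X b, X a ^ 2 * X b ^ 3, X a * X b ^ 4, X b ^ 6] :
        Fin 5 → MvPolynomial (Fin n) k) 3) := by
  classical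
  set c : Fin 5 → MvPolynomial (Fin n) k :=
    ![X a ^ 4, X a ^ 3 * X b, X a ^ 2 * X b ^ 3, X a * X b ^ 4, X b ^ 6] with hc
  have hc0 : c 0 = X a ^ 4 := rfl
  have hc1 : c 1 = X a ^ 3 * X b := rfl
  have hc2 : c 2 = X a ^ 2 * X b ^ 3 := rfl
  have hc3 : c 3 = X a * X b ^ 4 := rfl
  have hc4 : c 4 = X b ^ 6 := rfl
  have hba : b ≠ a := fun h => hab h.symm
  set L := Localization.Away (c 3)
  set ι := algebraMap (MvPolynomial (Fin n) k) L with hιdef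
  have hu : ι (c 3) * Away.invSelf (c 3) = 1 := Away.mul_invSelf (c 3)
  -- the chart map and the substitution
  let Θ : MvPolynomial (Fin n) k →ₐ[k] L :=
    aeval fun s => if s = a then ι (c 4) * Away.invSelf (c 3)
      else if s = b then ι (c 1) * Away.invSelf (c 3) else ι (X s)
  let ω : MvPolynomial (Fin n) k →ₐ[k] MvPolynomial (Fin n) k :=
    aeval fun s => if s = a then X a ^ 3 * X b ^ 2 else if s = b then X a ^ 2 * X b else X s
  have hΘa : Θ (X a) = ι (c 4) * Away.invSelf (c 3) := by simp [Θ]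
  have hΘb : Θ (X b) = ι (c 1) * Away.invSelf (c 3) := by simp [Θ, hba]
  have hΘs : ∀ s, s ≠ a → s ≠ b → Θ (X s) = ι (X s) := fun s hs hs' => by simp [Θ, hs, hs']
  have hωa : ω (X a) = X a ^ 3 * X b ^ 2 := by simp [ω]
  have hωb : ω (X b) = X a ^ 2 * X b := by simp [ω, hba]
  have hωs : ∀ s, s ≠ a → s ≠ b → ω (X s) = X s := fun s hs hs' => by simp [ω, hs, hs']
  have hωc3 : ω (c 3) = X a ^ 11 * X b ^ 6 := by
    rw [hc3, map_mul, map_pow, hωa, hωb]; ring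
  have E := fun (A B : MvPolynomial (Fin n) k) (d d' : ℕ) (h : A * c 3 ^ d' = B * c 3 ^ d) =>
    algebraMap_mul_invSelf_pow_eq (c 3) A B d d' h
  refine isRegularRing_chartRing_of_chartData c 3 ?_ Θ ω ?_ ?_ ?_ ?_ ?_
  · rw [hc3]; exact mul_ne_zero (X_ne_zero a) (pow_ne_zero _ (X_ne_zero b))
  · intro s
    by_cases hs : s = a
    · subst hs
      rw [hωa, map_mul, map_pow, map_pow, hΘa, hΘb]
      have key := E (c 4 ^ 3 * c 1 ^ 2) (X s) 5 0 (by rw [hc4, hc1, hc3]; ring)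
      rw [pow_zero, mul_one, map_mul, map_pow, map_pow] at key
      rw [← key]
      ring
    · by_cases hs' : s = b
      · subst hs'
        rw [hωb, map_mul, map_pow, hΘa, hΘb]
        have key := E (c 4 ^ 2 * c 1) (X s) 3 0 (by rw [hc4, hc1, hc3]; ring)
        rw [pow_zero, mul_one, map_mul, map_pow] at key
        rw [← key]
        ring
      · rw [hωs s hs hs', hΘs s hs hs']
  · intro s
    by_cases hs : s = a
    · subst hs
      rw [hΘa]
      exact div_mem_blowupAlgebra _ _ (Ideal.mem_span_range_self (f := c) (x := 4))
    · by_cases hs' : s = b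
      · subst hs'
        rw [hΘb]
        exact div_mem_blowupAlgebra _ _ (Ideal.mem_span_range_self (f := c) (x := 1))
      · rw [hΘs s hs hs']
        exact Subalgebra.algebraMap_mem _ _
  · intro j
    fin_cases j
    · refine ⟨X a * X b ^ 2, ?_⟩
      change Θ _ = ι (c 0) * _
      have key := E (c 4 * c 1 ^ 2) (c 0) 3 1 (by rw [hc4, hc1, hc3, hc0]; ring)
      rw [pow_one, map_mul, map_pow] at key
      rw [map_mul, map_pow, hΘa, hΘb, ← key]
      ring
    · exact ⟨X b, hΘb⟩
    · refine ⟨X a * X b, ?_⟩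
      change Θ _ = ι (c 2) * _
      have key := E (c 4 * c 1) (c 2) 2 1 (by rw [hc4, hc1, hc3, hc2]; ring)
      rw [pow_one, map_mul] at key
      rw [map_mul, hΘa, hΘb, ← key]
      ring
    · refine ⟨1, ?_⟩
      change Θ 1 = ι (c 3) * _
      rw [map_one, hu]
    · exact ⟨X a, hΘa⟩
  · exact ⟨X b ^ 38, 11, by rw [hωc3, hc3]; ring⟩
  · intro s
    by_cases hs : s = a
    · subst hs
      refine ⟨c 4, 1, by rw [hΘa, pow_one], ?_⟩
      rw [pow_one, hωc3, hc4, map_pow, hωb]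
      ring
    · by_cases hs' : s = b
      · subst hs'
        refine ⟨c 1, 1, by rw [hΘb, pow_one], ?_⟩
        rw [pow_one, hωc3, hc1, map_mul, map_pow, hωa, hωb]
        ring
      · exact ⟨X s, 0, by rw [hΘs s hs hs', pow_zero, mul_one],
          by rw [pow_zero, mul_one, hωs s hs hs']⟩

end K3

end Summit.ResolutionOfSingularities.ResolutionOfSingularities.Theorems.WildQuotientResolution.JordanThree

end
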